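import Summits.CriticalPhenomena.PercolationContinuityZ3.Theorems.SahiMasterFamilyPointwiseStrata
import Summits.CriticalPhenomena.PercolationContinuityZ3.Theorems.SahiMasterFamilyPrincipalCapC4

/-!
# (M⁺-4) on the principal-cap stratum — the order-four certificate at the COMB level — and pointwise (EQ-4) for
# principal-cap and TERMINAL quadruples

Unit `prim-master-conj` (crux anchor stmt-CriticalPhenomena-4575, helper work), gen 13; companion of `SahiMasterFamilyPointwiseStrata.lean`
(order three).  Seat P4's sixteen-term certificate for Sahi's `C₄` on the principal-cap stratum (`PrincipalCapC3.key_ineq4`,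
`sahiE4_nonneg_of_principalCap`, law level) is a sum of products of probabilities `m_X`, cylinder probabilities `P_X`, defect moments
`P_S − m_S = μ([K_S] ∖ ⋂_S U)` and Harris gaps `m_{XY} − m_X m_Y = Cov(U_X, U_Y)`, of total degree `≤ 4` in each coordinate; every atom is
comb-positive (`combPos_ex_ind`, `SahiCombDomination.combPos_ex_sub_of_subset`, (M⁺-2) = `combPos_covFun`), so the certificate lifts verbatim:

* `combPos_sahiE4_of_principalCap` / `combPos_sahiE_four_of_principalCap` — **(M⁺-4) on the principal-cap stratum**: four increasing events
  with cylinder common part `⋂ U_j = {T | c ⊆ T}` have `p ↦ E₄(μ_p; 1_U)` a nonnegative combination of the degree-4 tensor-Bernstein basis;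
* `sahiE_four_ind_eq_zero_iff_of_principalCap` — **pointwise (EQ-4) there**: at every interior `p`, `E₄(μ_p; 1_U) = 0 ↔ U ∈ Z₄`
  (`Pointwise.sahiE_ind_eq_zero_iff_of_combPos`, i.e. (EQI-4) + density-free zeros), with the strict form off `Z₄`;
* `sahiE_four_ind_eq_zero_iff_of_terminal` — **pointwise (EQ-4) for TERMINAL quadruples**: by this unit's `GluedFrames.terminalTight_all`
  (gen 12: (TT_k) at every order) a terminal quadruple — increasing, non-empty, non-sure events determined by `S` with no `Z₃` deletion, no common
  pivotal coordinate, no private coordinate, all minors in `Z₄` and no member containing the others — is principal-cap; hence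
  `E₄(μ_p; 1_U) > 0` at EVERY interior `p` (`sahiE_four_ind_pos_of_terminal`; the tree had "`≠ 0` somewhere").
Nothing here asserts (M⁺-4), (EQ-4) or `C₄` in general.  Axioms standard. [this work]
-/

noncomputable section

open scoped Classical

namespace Summit.CriticalPhenomena.PercolationContinuityZ3.Theorems

open Finset Function MeasureTheory
open Literature.Combinatorics.Sahi2008
open Literature.Probability.LatticeModels (prodBernoulli sahiE4 sahiE4_def)
open Literature.Probability.LatticeModels.Kahn2022 (Affects)
open Literature.Probability.Percolation (DeterminedBy)
open Literature.Probability.Percolation.DecisionTree (ind)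
open SahiComb

namespace Pointwise

section PrincipalCapFour

variable {ι : Type} [Fintype ι]

/-- **(M⁺-4) on the principal-cap stratum.**  Four increasing events with cylinder common part `A ∩ B ∩ C ∩ D = {T | ↑c ⊆ T}` have
`p ↦ E₄(μ_p; 1_A, 1_B, 1_C, 1_D)` comb-positive at multidegree `4` (P4's certificate `key_ineq4`, atom by atom; cores disjointified as in
`PrincipalCapC3.sahiE4_nonneg_of_principalCap`). [this work] -/
theorem combPos_sahiE4_of_principalCap {A B C D : Set (Set ι)} (hAu : IsUpperSet A) (hBu : IsUpperSet B) (hCu : IsUpperSet C)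
    (hDu : IsUpperSet D) (c : Finset ι) (hpc : ∀ T : Set ι, (T ∈ A ∧ T ∈ B ∧ T ∈ C ∧ T ∈ D) ↔ (↑c : Set ι) ⊆ T) :
    CombPos (fun _ : ι => 4) (fun p => sahiE (bernoulliWeight p) 4 ![ind A, ind B, ind C, ind D]) := by
  -- disjointified cores (verbatim from `PrincipalCapC3.sahiE4_nonneg_of_principalCap`)
  set KA : Finset ι := c.filter fun e => Set.univ \ {e} ∉ A with hKAdef
  set KB : Finset ι := (c.filter fun e => Set.univ \ {e} ∉ B) \ KA with hKBdef
  set KC : Finset ι := ((c.filter fun e => Set.univ \ {e} ∉ C) \ KA) \ KB with hKCdef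
  set KD : Finset ι := ((c \ KA) \ KB) \ KC with hKDdef
  have hcA : ∀ e ∈ KA, Set.univ \ {e} ∉ A := fun e he => (mem_filter.1 he).2
  have hcB : ∀ e ∈ KB, Set.univ \ {e} ∉ B := fun e he => (mem_filter.1 (mem_sdiff.1 he).1).2
  have hcC : ∀ e ∈ KC, Set.univ \ {e} ∉ C := fun e he => (mem_filter.1 (mem_sdiff.1 (mem_sdiff.1 he).1).1).2
  have hcD : ∀ e ∈ KD, Set.univ \ {e} ∉ D := by
    intro e he hmem
    have hec : e ∈ c := (mem_sdiff.1 (mem_sdiff.1 (mem_sdiff.1 he).1).1).1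
    have heA : e ∉ KA := (mem_sdiff.1 (mem_sdiff.1 (mem_sdiff.1 he).1).1).2
    have heB : e ∉ KB := (mem_sdiff.1 (mem_sdiff.1 he).1).2
    have heC : e ∉ KC := (mem_sdiff.1 he).2
    have hA' : Set.univ \ {e} ∈ A := by by_contra h; exact heA (mem_filter.2 ⟨hec, h⟩)
    have hB' : Set.univ \ {e} ∈ B := by by_contra h; exact heB (mem_sdiff.2 ⟨mem_filter.2 ⟨hec, h⟩, heA⟩)
    have hC' : Set.univ \ {e} ∈ C := by
      by_contra h; exact heC (mem_sdiff.2 ⟨mem_sdiff.2 ⟨mem_filter.2 ⟨hec, h⟩, heA⟩, heB⟩)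
    have hsub := (hpc _).1 ⟨hA', hB', hC', hmem⟩
    exact (hsub (mem_coe.2 hec)).2 rfl
  have hA : A ⊆ {ω : Set ι | (↑KA : Set ι) ⊆ ω} := PrincipalCapC3.subset_cyl_of_core hAu hcA
  have hB : B ⊆ {ω : Set ι | (↑KB : Set ι) ⊆ ω} := PrincipalCapC3.subset_cyl_of_core hBu hcB
  have hC : C ⊆ {ω : Set ι | (↑KC : Set ι) ⊆ ω} := PrincipalCapC3.subset_cyl_of_core hCu hcC
  have hD : D ⊆ {ω : Set ι | (↑KD : Set ι) ⊆ ω} := PrincipalCapC3.subset_cyl_of_core hDu hcD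
  have dAB : Disjoint KA KB := disjoint_sdiff
  have dAC : Disjoint KA KC := by
    rw [Finset.disjoint_left]; intro e h1 h2; exact (mem_sdiff.1 (mem_sdiff.1 h2).1).2 h1
  have dAD : Disjoint KA KD := by
    rw [Finset.disjoint_left]; intro e h1 h2; exact (mem_sdiff.1 (mem_sdiff.1 (mem_sdiff.1 h2).1).1).2 h1
  have dBC : Disjoint KB KC := by
    rw [Finset.disjoint_left]; intro e h1 h2; exact (mem_sdiff.1 h2).2 h1
  have dBD : Disjoint KB KD := by
    rw [Finset.disjoint_left]; intro e h1 h2; exact (mem_sdiff.1 (mem_sdiff.1 h2).1).2 h1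
  have dCD : Disjoint KC KD := by
    rw [Finset.disjoint_left]; intro e h1 h2; exact (mem_sdiff.1 h2).2 h1
  have hcov : KA ∪ KB ∪ KC ∪ KD = c := by
    ext e
    simp only [mem_union]
    constructor
    · rintro (((h | h) | h) | h)
      · exact (mem_filter.1 h).1
      · exact (mem_filter.1 (mem_sdiff.1 h).1).1
      · exact (mem_filter.1 (mem_sdiff.1 (mem_sdiff.1 h).1).1).1
      · exact (mem_sdiff.1 (mem_sdiff.1 (mem_sdiff.1 h).1).1).1
    · intro hec
      by_cases h1 : e ∈ KA
      · exact Or.inl (Or.inl (Or.inl h1))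
      · by_cases h2 : e ∈ KB
        · exact Or.inl (Or.inl (Or.inr h2))
        · by_cases h3 : e ∈ KC
          · exact Or.inl (Or.inr h3)
          · exact Or.inr (mem_sdiff.2 ⟨mem_sdiff.2 ⟨mem_sdiff.2 ⟨hec, h1⟩, h2⟩, h3⟩)
  -- inclusions feeding the defect moments
  have hAB : A ∩ B ⊆ {ω : Set ι | (↑KA : Set ι) ⊆ ω} ∩ {ω : Set ι | (↑KB : Set ι) ⊆ ω} := Set.inter_subset_inter hA hB
  have hAC : A ∩ C ⊆ {ω : Set ι | (↑KA : Set ι) ⊆ ω} ∩ {ω : Set ι | (↑KC : Set ι) ⊆ ω} := Set.inter_subset_inter hA hC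
  have hAD : A ∩ D ⊆ {ω : Set ι | (↑KA : Set ι) ⊆ ω} ∩ {ω : Set ι | (↑KD : Set ι) ⊆ ω} := Set.inter_subset_inter hA hD
  have hBC : B ∩ C ⊆ {ω : Set ι | (↑KB : Set ι) ⊆ ω} ∩ {ω : Set ι | (↑KC : Set ι) ⊆ ω} := Set.inter_subset_inter hB hC
  have hBD : B ∩ D ⊆ {ω : Set ι | (↑KB : Set ι) ⊆ ω} ∩ {ω : Set ι | (↑KD : Set ι) ⊆ ω} := Set.inter_subset_inter hB hD
  have hCD : C ∩ D ⊆ {ω : Set ι | (↑KC : Set ι) ⊆ ω} ∩ {ω : Set ι | (↑KD : Set ι) ⊆ ω} := Set.inter_subset_inter hC hD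
  have hABC : A ∩ B ∩ C ⊆
      {ω : Set ι | (↑KA : Set ι) ⊆ ω} ∩ {ω : Set ι | (↑KB : Set ι) ⊆ ω} ∩ {ω : Set ι | (↑KC : Set ι) ⊆ ω} :=
    Set.inter_subset_inter (Set.inter_subset_inter hA hB) hC
  have hABD : A ∩ B ∩ D ⊆
      {ω : Set ι | (↑KA : Set ι) ⊆ ω} ∩ {ω : Set ι | (↑KB : Set ι) ⊆ ω} ∩ {ω : Set ι | (↑KD : Set ι) ⊆ ω} :=
    Set.inter_subset_inter (Set.inter_subset_inter hA hB) hD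
  have hACD : A ∩ C ∩ D ⊆
      {ω : Set ι | (↑KA : Set ι) ⊆ ω} ∩ {ω : Set ι | (↑KC : Set ι) ⊆ ω} ∩ {ω : Set ι | (↑KD : Set ι) ⊆ ω} :=
    Set.inter_subset_inter (Set.inter_subset_inter hA hC) hD
  have hBCD : B ∩ C ∩ D ⊆
      {ω : Set ι | (↑KB : Set ι) ⊆ ω} ∩ {ω : Set ι | (↑KC : Set ι) ⊆ ω} ∩ {ω : Set ι | (↑KD : Set ι) ⊆ ω} :=
    Set.inter_subset_inter (Set.inter_subset_inter hB hC) hD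
  have hcABCD : {ω : Set ι | (↑c : Set ι) ⊆ ω} ⊆ A ∩ B ∩ C ∩ D := by
    intro ω hω
    obtain ⟨h1, h2, h3, h4⟩ := (hpc ω).2 hω
    exact ⟨⟨⟨h1, h2⟩, h3⟩, h4⟩
  -- multidegree bookkeeping
  have d11 : (fun _ : ι => (1 : ℕ)) + (fun _ : ι => 1) = fun _ : ι => 2 := by funext e; simp
  have d12 : (fun _ : ι => (1 : ℕ)) + (fun _ : ι => 2) = fun _ : ι => 3 := by funext e; simp
  have d21 : (fun _ : ι => (2 : ℕ)) + (fun _ : ι => 1) = fun _ : ι => 3 := by funext e; simp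
  have d22 : (fun _ : ι => (2 : ℕ)) + (fun _ : ι => 2) = fun _ : ι => 4 := by funext e; simp
  have d31 : (fun _ : ι => (3 : ℕ)) + (fun _ : ι => 1) = fun _ : ι => 4 := by funext e; simp
  have d14 : (fun _ : ι => (1 : ℕ)) ≤ (fun _ : ι => 4) := fun e => by norm_num
  have d24 : (fun _ : ι => (2 : ℕ)) ≤ (fun _ : ι => 4) := fun e => by norm_num
  have d34 : (fun _ : ι => (3 : ℕ)) ≤ (fun _ : ι => 4) := fun e => by norm_num
  -- the seventeen comb-positive pieces
  have T1 : CombPos (fun _ : ι => 4) (fun p => 2 * (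
        ex (bernoulliWeight p) (ind (A)) *
          (ex (bernoulliWeight p) (ind ({ω : Set ι | (↑KB : Set ι) ⊆ ω} ∩ {ω : Set ι | (↑KC : Set ι) ⊆ ω} ∩ {ω : Set ι | (↑KD : Set ι) ⊆ ω})) -
            ex (bernoulliWeight p) (ind (B ∩ C ∩ D))))) :=
    ((((combPos_ex_ind (A)).mul_of_eq
      (SahiCombDomination.combPos_ex_sub_of_subset hBCD) d11).smul (by norm_num : (0:ℝ) ≤ 2)).mono d24)
  have T2 : CombPos (fun _ : ι => 4) (fun p => 2 * (
        ex (bernoulliWeight p) (ind (B)) *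
          (ex (bernoulliWeight p) (ind ({ω : Set ι | (↑KA : Set ι) ⊆ ω} ∩ {ω : Set ι | (↑KC : Set ι) ⊆ ω} ∩ {ω : Set ι | (↑KD : Set ι) ⊆ ω})) -
            ex (bernoulliWeight p) (ind (A ∩ C ∩ D))))) :=
    ((((combPos_ex_ind (B)).mul_of_eq
      (SahiCombDomination.combPos_ex_sub_of_subset hACD) d11).smul (by norm_num : (0:ℝ) ≤ 2)).mono d24)
  have T3 : CombPos (fun _ : ι => 4) (fun p => 2 * (
        ex (bernoulliWeight p) (ind (C)) *
          (ex (bernoulliWeight p) (ind ({ω : Set ι | (↑KA : Set ι) ⊆ ω} ∩ {ω : Set ι | (↑KB : Set ι) ⊆ ω} ∩ {ω : Set ι | (↑KD : Set ι) ⊆ ω})) -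
            ex (bernoulliWeight p) (ind (A ∩ B ∩ D))))) :=
    ((((combPos_ex_ind (C)).mul_of_eq
      (SahiCombDomination.combPos_ex_sub_of_subset hABD) d11).smul (by norm_num : (0:ℝ) ≤ 2)).mono d24)
  have T4 : CombPos (fun _ : ι => 4) (fun p => 2 * (
        ex (bernoulliWeight p) (ind (D)) *
          (ex (bernoulliWeight p) (ind ({ω : Set ι | (↑KA : Set ι) ⊆ ω} ∩ {ω : Set ι | (↑KB : Set ι) ⊆ ω} ∩ {ω : Set ι | (↑KC : Set ι) ⊆ ω})) -
            ex (bernoulliWeight p) (ind (A ∩ B ∩ C))))) :=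
    ((((combPos_ex_ind (D)).mul_of_eq
      (SahiCombDomination.combPos_ex_sub_of_subset hABC) d11).smul (by norm_num : (0:ℝ) ≤ 2)).mono d24)
  have T5 : CombPos (fun _ : ι => 4) (fun p => 
        (ex (bernoulliWeight p) (ind ({ω : Set ι | (↑KA : Set ι) ⊆ ω} ∩ {ω : Set ι | (↑KB : Set ι) ⊆ ω})) -
            ex (bernoulliWeight p) (ind (A ∩ B))) *
          covFun C D p) :=
    (((SahiCombDomination.combPos_ex_sub_of_subset hAB).mul_of_eq
      (combPos_covFun C D hCu hDu) d12).mono d34)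
  have T6 : CombPos (fun _ : ι => 4) (fun p => 
        (ex (bernoulliWeight p) (ind ({ω : Set ι | (↑KA : Set ι) ⊆ ω} ∩ {ω : Set ι | (↑KC : Set ι) ⊆ ω})) -
            ex (bernoulliWeight p) (ind (A ∩ C))) *
          (ex (bernoulliWeight p) (ind ({ω : Set ι | (↑KB : Set ι) ⊆ ω} ∩ {ω : Set ι | (↑KD : Set ι) ⊆ ω})) -
            ex (bernoulliWeight p) (ind (B ∩ D)))) :=
    (((SahiCombDomination.combPos_ex_sub_of_subset hAC).mul_of_eq
      (SahiCombDomination.combPos_ex_sub_of_subset hBD) d11).mono d24)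
  have T7 : CombPos (fun _ : ι => 4) (fun p => 
        (ex (bernoulliWeight p) (ind ({ω : Set ι | (↑KA : Set ι) ⊆ ω} ∩ {ω : Set ι | (↑KC : Set ι) ⊆ ω})) -
            ex (bernoulliWeight p) (ind (A ∩ C))) *
          covFun B D p) :=
    (((SahiCombDomination.combPos_ex_sub_of_subset hAC).mul_of_eq
      (combPos_covFun B D hBu hDu) d12).mono d34)
  have T8 : CombPos (fun _ : ι => 4) (fun p => 
        (ex (bernoulliWeight p) (ind ({ω : Set ι | (↑KA : Set ι) ⊆ ω} ∩ {ω : Set ι | (↑KD : Set ι) ⊆ ω})) -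
            ex (bernoulliWeight p) (ind (A ∩ D))) *
          covFun B C p) :=
    (((SahiCombDomination.combPos_ex_sub_of_subset hAD).mul_of_eq
      (combPos_covFun B C hBu hCu) d12).mono d34)
  have T9 : CombPos (fun _ : ι => 4) (fun p => 
        (ex (bernoulliWeight p) (ind ({ω : Set ι | (↑KB : Set ι) ⊆ ω} ∩ {ω : Set ι | (↑KD : Set ι) ⊆ ω})) -
            ex (bernoulliWeight p) (ind (B ∩ D))) *
          covFun A C p) :=
    (((SahiCombDomination.combPos_ex_sub_of_subset hBD).mul_of_eq
      (combPos_covFun A C hAu hCu) d12).mono d34)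
  have T10 : CombPos (fun _ : ι => 4) (fun p => 
        (ex (bernoulliWeight p) (ind ({ω : Set ι | (↑KA : Set ι) ⊆ ω})) -
            ex (bernoulliWeight p) (ind (A))) *
          (ex (bernoulliWeight p) (ind ({ω : Set ι | (↑KD : Set ι) ⊆ ω})) -
            ex (bernoulliWeight p) (ind (D))) *
          covFun B C p) :=
    (((SahiCombDomination.combPos_ex_sub_of_subset hA).mul_of_eq
      (SahiCombDomination.combPos_ex_sub_of_subset hD) d11).mul_of_eq
      (combPos_covFun B C hBu hCu) d22)
  have T11 : CombPos (fun _ : ι => 4) (fun p => 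
        (ex (bernoulliWeight p) (ind ({ω : Set ι | (↑KA : Set ι) ⊆ ω})) -
            ex (bernoulliWeight p) (ind (A))) *
          (ex (bernoulliWeight p) (ind ({ω : Set ι | (↑KB : Set ι) ⊆ ω} ∩ {ω : Set ι | (↑KC : Set ι) ⊆ ω})) -
            ex (bernoulliWeight p) (ind (B ∩ C))) *
          ex (bernoulliWeight p) (ind ({ω : Set ι | (↑KD : Set ι) ⊆ ω}))) :=
    ((((SahiCombDomination.combPos_ex_sub_of_subset hA).mul_of_eq
      (SahiCombDomination.combPos_ex_sub_of_subset hBC) d11).mul_of_eq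
      (combPos_ex_ind {ω : Set ι | (↑KD : Set ι) ⊆ ω}) d21).mono d34)
  have T12 : CombPos (fun _ : ι => 4) (fun p => 
        (ex (bernoulliWeight p) (ind ({ω : Set ι | (↑KA : Set ι) ⊆ ω})) -
            ex (bernoulliWeight p) (ind (A))) *
          (ex (bernoulliWeight p) (ind ({ω : Set ι | (↑KC : Set ι) ⊆ ω} ∩ {ω : Set ι | (↑KD : Set ι) ⊆ ω})) -
            ex (bernoulliWeight p) (ind (C ∩ D))) *
          ex (bernoulliWeight p) (ind ({ω : Set ι | (↑KB : Set ι) ⊆ ω}))) :=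
    ((((SahiCombDomination.combPos_ex_sub_of_subset hA).mul_of_eq
      (SahiCombDomination.combPos_ex_sub_of_subset hCD) d11).mul_of_eq
      (combPos_ex_ind {ω : Set ι | (↑KB : Set ι) ⊆ ω}) d21).mono d34)
  have T13 : CombPos (fun _ : ι => 4) (fun p => 
        ex (bernoulliWeight p) (ind (A)) *
          (ex (bernoulliWeight p) (ind ({ω : Set ι | (↑KB : Set ι) ⊆ ω})) -
            ex (bernoulliWeight p) (ind (B))) *
          (ex (bernoulliWeight p) (ind ({ω : Set ι | (↑KC : Set ι) ⊆ ω} ∩ {ω : Set ι | (↑KD : Set ι) ⊆ ω})) -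
            ex (bernoulliWeight p) (ind (C ∩ D)))) :=
    ((((combPos_ex_ind (A)).mul_of_eq
      (SahiCombDomination.combPos_ex_sub_of_subset hB) d11).mul_of_eq
      (SahiCombDomination.combPos_ex_sub_of_subset hCD) d21).mono d34)
  have T14 : CombPos (fun _ : ι => 4) (fun p => 
        (ex (bernoulliWeight p) (ind ({ω : Set ι | (↑KD : Set ι) ⊆ ω})) -
            ex (bernoulliWeight p) (ind (D))) *
          (ex (bernoulliWeight p) (ind ({ω : Set ι | (↑KB : Set ι) ⊆ ω} ∩ {ω : Set ι | (↑KC : Set ι) ⊆ ω})) -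
            ex (bernoulliWeight p) (ind (B ∩ C))) *
          ex (bernoulliWeight p) (ind ({ω : Set ι | (↑KA : Set ι) ⊆ ω}))) :=
    ((((SahiCombDomination.combPos_ex_sub_of_subset hD).mul_of_eq
      (SahiCombDomination.combPos_ex_sub_of_subset hBC) d11).mul_of_eq
      (combPos_ex_ind {ω : Set ι | (↑KA : Set ι) ⊆ ω}) d21).mono d34)
  have T15 : CombPos (fun _ : ι => 4) (fun p => 
        (ex (bernoulliWeight p) (ind ({ω : Set ι | (↑KA : Set ι) ⊆ ω})) -
            ex (bernoulliWeight p) (ind (A))) *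
          (ex (bernoulliWeight p) (ind ({ω : Set ι | (↑KB : Set ι) ⊆ ω})) -
            ex (bernoulliWeight p) (ind (B))) *
          (ex (bernoulliWeight p) (ind ({ω : Set ι | (↑KC : Set ι) ⊆ ω})) -
            ex (bernoulliWeight p) (ind (C))) *
          ex (bernoulliWeight p) (ind ({ω : Set ι | (↑KD : Set ι) ⊆ ω}))) :=
    ((((SahiCombDomination.combPos_ex_sub_of_subset hA).mul_of_eq
      (SahiCombDomination.combPos_ex_sub_of_subset hB) d11).mul_of_eq
      (SahiCombDomination.combPos_ex_sub_of_subset hC) d21).mul_of_eq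
      (combPos_ex_ind {ω : Set ι | (↑KD : Set ι) ⊆ ω}) d31)
  have T16 : CombPos (fun _ : ι => 4) (fun p => 
        (ex (bernoulliWeight p) (ind ({ω : Set ι | (↑KB : Set ι) ⊆ ω})) -
            ex (bernoulliWeight p) (ind (B))) *
          (ex (bernoulliWeight p) (ind ({ω : Set ι | (↑KC : Set ι) ⊆ ω})) -
            ex (bernoulliWeight p) (ind (C))) *
          (ex (bernoulliWeight p) (ind ({ω : Set ι | (↑KD : Set ι) ⊆ ω})) -
            ex (bernoulliWeight p) (ind (D))) *
          ex (bernoulliWeight p) (ind ({ω : Set ι | (↑KA : Set ι) ⊆ ω}))) :=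
    ((((SahiCombDomination.combPos_ex_sub_of_subset hB).mul_of_eq
      (SahiCombDomination.combPos_ex_sub_of_subset hC) d11).mul_of_eq
      (SahiCombDomination.combPos_ex_sub_of_subset hD) d21).mul_of_eq
      (combPos_ex_ind {ω : Set ι | (↑KA : Set ι) ⊆ ω}) d31)
  have T17 : CombPos (fun _ : ι => 4) (fun p =>
      6 * (ex (bernoulliWeight p) (ind (A ∩ B ∩ C ∩ D)) -
        ex (bernoulliWeight p) (ind ({ω : Set ι | (↑c : Set ι) ⊆ ω})))) :=
    ((SahiCombDomination.combPos_ex_sub_of_subset hcABCD).smul (by norm_num : (0:ℝ) ≤ 6)).mono d14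
  refine ((((((((((((((((T1.add T2).add T3).add T4).add T5).add T6).add T7).add T8).add T9).add T10).add T11).add T12).add T13).add T14).add T15).add T16).add T17).congr
    fun p => ?_
  -- the identity at `p`: cylinder intersections are products
  have hPAB : (prodBernoulli p).real ({ω : Set ι | (↑KA : Set ι) ⊆ ω} ∩ {ω : Set ι | (↑KB : Set ι) ⊆ ω}) =
      (∏ e ∈ KA, (p e : ℝ)) * (∏ e ∈ KB, (p e : ℝ)) := by
    rw [PrincipalCapC3.cyl_inter, PrincipalCapC3.real_cyl, prod_union dAB]
  have hPAC : (prodBernoulli p).real ({ω : Set ι | (↑KA : Set ι) ⊆ ω} ∩ {ω : Set ι | (↑KC : Set ι) ⊆ ω}) =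
      (∏ e ∈ KA, (p e : ℝ)) * (∏ e ∈ KC, (p e : ℝ)) := by
    rw [PrincipalCapC3.cyl_inter, PrincipalCapC3.real_cyl, prod_union dAC]
  have hPAD : (prodBernoulli p).real ({ω : Set ι | (↑KA : Set ι) ⊆ ω} ∩ {ω : Set ι | (↑KD : Set ι) ⊆ ω}) =
      (∏ e ∈ KA, (p e : ℝ)) * (∏ e ∈ KD, (p e : ℝ)) := by
    rw [PrincipalCapC3.cyl_inter, PrincipalCapC3.real_cyl, prod_union dAD]
  have hPBC : (prodBernoulli p).real ({ω : Set ι | (↑KB : Set ι) ⊆ ω} ∩ {ω : Set ι | (↑KC : Set ι) ⊆ ω}) =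
      (∏ e ∈ KB, (p e : ℝ)) * (∏ e ∈ KC, (p e : ℝ)) := by
    rw [PrincipalCapC3.cyl_inter, PrincipalCapC3.real_cyl, prod_union dBC]
  have hPBD : (prodBernoulli p).real ({ω : Set ι | (↑KB : Set ι) ⊆ ω} ∩ {ω : Set ι | (↑KD : Set ι) ⊆ ω}) =
      (∏ e ∈ KB, (p e : ℝ)) * (∏ e ∈ KD, (p e : ℝ)) := by
    rw [PrincipalCapC3.cyl_inter, PrincipalCapC3.real_cyl, prod_union dBD]
  have hPCD : (prodBernoulli p).real ({ω : Set ι | (↑KC : Set ι) ⊆ ω} ∩ {ω : Set ι | (↑KD : Set ι) ⊆ ω}) =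
      (∏ e ∈ KC, (p e : ℝ)) * (∏ e ∈ KD, (p e : ℝ)) := by
    rw [PrincipalCapC3.cyl_inter, PrincipalCapC3.real_cyl, prod_union dCD]
  have hPABC : (prodBernoulli p).real ({ω : Set ι | (↑KA : Set ι) ⊆ ω} ∩ {ω : Set ι | (↑KB : Set ι) ⊆ ω} ∩
      {ω : Set ι | (↑KC : Set ι) ⊆ ω}) = (∏ e ∈ KA, (p e : ℝ)) * (∏ e ∈ KB, (p e : ℝ)) * (∏ e ∈ KC, (p e : ℝ)) := by
    rw [PrincipalCapC3.cyl_inter, PrincipalCapC3.cyl_inter, PrincipalCapC3.real_cyl,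
      prod_union (disjoint_union_left.2 ⟨dAC, dBC⟩), prod_union dAB]
  have hPABD : (prodBernoulli p).real ({ω : Set ι | (↑KA : Set ι) ⊆ ω} ∩ {ω : Set ι | (↑KB : Set ι) ⊆ ω} ∩
      {ω : Set ι | (↑KD : Set ι) ⊆ ω}) = (∏ e ∈ KA, (p e : ℝ)) * (∏ e ∈ KB, (p e : ℝ)) * (∏ e ∈ KD, (p e : ℝ)) := by
    rw [PrincipalCapC3.cyl_inter, PrincipalCapC3.cyl_inter, PrincipalCapC3.real_cyl,
      prod_union (disjoint_union_left.2 ⟨dAD, dBD⟩), prod_union dAB]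
  have hPACD : (prodBernoulli p).real ({ω : Set ι | (↑KA : Set ι) ⊆ ω} ∩ {ω : Set ι | (↑KC : Set ι) ⊆ ω} ∩
      {ω : Set ι | (↑KD : Set ι) ⊆ ω}) = (∏ e ∈ KA, (p e : ℝ)) * (∏ e ∈ KC, (p e : ℝ)) * (∏ e ∈ KD, (p e : ℝ)) := by
    rw [PrincipalCapC3.cyl_inter, PrincipalCapC3.cyl_inter, PrincipalCapC3.real_cyl,
      prod_union (disjoint_union_left.2 ⟨dAD, dCD⟩), prod_union dAC]
  have hPBCD : (prodBernoulli p).real ({ω : Set ι | (↑KB : Set ι) ⊆ ω} ∩ {ω : Set ι | (↑KC : Set ι) ⊆ ω} ∩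
      {ω : Set ι | (↑KD : Set ι) ⊆ ω}) = (∏ e ∈ KB, (p e : ℝ)) * (∏ e ∈ KC, (p e : ℝ)) * (∏ e ∈ KD, (p e : ℝ)) := by
    rw [PrincipalCapC3.cyl_inter, PrincipalCapC3.cyl_inter, PrincipalCapC3.real_cyl,
      prod_union (disjoint_union_left.2 ⟨dBD, dCD⟩), prod_union dBC]
  have hPABCD : (prodBernoulli p).real {ω : Set ι | (↑c : Set ι) ⊆ ω} =
      (∏ e ∈ KA, (p e : ℝ)) * (∏ e ∈ KB, (p e : ℝ)) * (∏ e ∈ KC, (p e : ℝ)) * ∏ e ∈ KD, (p e : ℝ) := by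
    rw [← hcov, PrincipalCapC3.real_cyl, prod_union (disjoint_union_left.2 ⟨disjoint_union_left.2 ⟨dAD, dBD⟩, dCD⟩),
      prod_union (disjoint_union_left.2 ⟨dAC, dBC⟩), prod_union dAB]
  rw [sahiE_four_ind, sahiE4_def]
  simp only [covFun, ex_bernoulliWeight_ind]
  rw [hPAB, hPAC, hPAD, hPBC, hPBD, hPCD, hPABC, hPABD, hPACD, hPBCD, hPABCD, PrincipalCapC3.real_cyl, PrincipalCapC3.real_cyl,
    PrincipalCapC3.real_cyl, PrincipalCapC3.real_cyl]
  ring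

/-- The same for a `Fin 4`-family (`fun j => ind (U j)`). [this work] -/
theorem combPos_sahiE_four_of_principalCap (U : Fin 4 → Set (Set ι)) (hU : ∀ j, IsUpperSet (U j)) (c : Finset ι)
    (hpc : ∀ T : Set ι, (∀ j, T ∈ U j) ↔ (↑c : Set ι) ⊆ T) :
    CombPos (fun _ : ι => 4) (fun p => sahiE (bernoulliWeight p) 4 (fun j => ind (U j))) := by
  have e : (fun j => ind (U j)) = ![ind (U 0), ind (U 1), ind (U 2), ind (U 3)] := by
    funext j; fin_cases j <;> rfl
  have hpc' : ∀ T : Set ι, (T ∈ U 0 ∧ T ∈ U 1 ∧ T ∈ U 2 ∧ T ∈ U 3) ↔ (↑c : Set ι) ⊆ T := by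
    intro T
    rw [← hpc T]
    constructor
    · rintro ⟨h0, h1, h2, h3⟩ j
      fin_cases j
      · exact h0
      · exact h1
      · exact h2
      · exact h3
    · intro h; exact ⟨h 0, h 1, h 2, h 3⟩
  exact (combPos_sahiE4_of_principalCap (hU 0) (hU 1) (hU 2) (hU 3) c hpc').congr fun p => by rw [e]

/-- **Pointwise (EQ-4) on the principal-cap stratum**: for `p` in the open cube and four increasing events with cylinder common part,
`E₄(μ_p; 1_U) = 0 ↔ U ∈ Z₄`. [this work] -/
theorem sahiE_four_ind_eq_zero_iff_of_principalCap (p : ι → unitInterval) (hp : ∀ e, (p e : ℝ) ∈ Set.Ioo (0 : ℝ) 1)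
    (U : Fin 4 → Set (Set ι)) (hU : ∀ j, IsUpperSet (U j)) (c : Finset ι)
    (hpc : ∀ T : Set ι, (∀ j, T ∈ U j) ↔ (↑c : Set ι) ⊆ T) :
    sahiE (bernoulliWeight p) 4 (fun j => ind (U j)) = 0 ↔ SuppZeroFlag 4 U :=
  sahiE_ind_eq_zero_iff_of_combPos hU (combPos_sahiE_four_of_principalCap U hU c hpc) hp

/-- Strict form: a principal-cap quadruple outside `Z₄` has `E₄(μ_p) > 0` at every interior `p`. [this work] -/
theorem sahiE_four_ind_pos_of_principalCap (p : ι → unitInterval) (hp : ∀ e, (p e : ℝ) ∈ Set.Ioo (0 : ℝ) 1)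
    (U : Fin 4 → Set (Set ι)) (hU : ∀ j, IsUpperSet (U j)) (c : Finset ι)
    (hpc : ∀ T : Set ι, (∀ j, T ∈ U j) ↔ (↑c : Set ι) ⊆ T) (hZ : ¬ SuppZeroFlag 4 U) :
    0 < sahiE (bernoulliWeight p) 4 (fun j => ind (U j)) :=
  sahiE_ind_pos_of_combPos hU (combPos_sahiE_four_of_principalCap U hU c hpc) hZ hp

/-! ### Terminal quadruples (via (TT_4), `GluedFrames.terminalTight_all`) -/

/-- **(M⁺-4) for terminal quadruples**: a family of four increasing, non-empty, non-sure events determined by `S`, with no `Z₃`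
deletion, no common pivotal coordinate, no private coordinate, all minors at coordinates of `S` in `Z₄`, and no member containing all the
others, is principal-cap (`GluedFrames.terminalTight_all 0 : TerminalTight 1`), hence comb-positive. [this work] -/
theorem combPos_sahiE_four_of_terminal (U : Fin 4 → Set (Set ι)) (S : Finset ι) (hU : ∀ j, IsUpperSet (U j))
    (hUS : ∀ j, DeterminedBy (U j) (↑S : Set ι)) (hne : ∀ j, (U j).Nonempty) (h0 : ∀ j, (∅ : Set ι) ∉ U j)
    (hno : ∀ m : Fin 4, ¬ SuppZeroFlag 3 (fun j => U (m.succAbove j)))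
    (hc : ¬ ∃ e : ι, ∀ j, ∃ ω, e ∉ ω ∧ ω ∉ U j ∧ insert e ω ∈ U j)
    (hpriv : ¬ ∃ e : ι, ∃ c : Fin 4, (∃ ω, e ∉ ω ∧ ω ∉ U c ∧ insert e ω ∈ U c) ∧ ∀ j, j ≠ c → ¬ Affects (U j) e)
    (hmin : ∀ e ∈ S, ∀ b : Bool, SuppZeroFlag 4 (fun j => secAt e b (U j)))
    (habs : ∀ j, ∃ l, l ≠ j ∧ ¬ U l ⊆ U j) :
    CombPos (fun _ : ι => 4) (fun p => sahiE (bernoulliWeight p) 4 (fun j => ind (U j))) := by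
  obtain ⟨c, hcap⟩ := GluedFrames.terminalTight_all 0 ι U S hU hUS hne h0 hno hc hpriv hmin habs
  exact combPos_sahiE_four_of_principalCap U hU c hcap

/-- **Pointwise (EQ-4) for terminal quadruples**: at every interior `p`, `E₄(μ_p; 1_U) = 0 ↔ U ∈ Z₄`. [this work] -/
theorem sahiE_four_ind_eq_zero_iff_of_terminal (p : ι → unitInterval) (hp : ∀ e, (p e : ℝ) ∈ Set.Ioo (0 : ℝ) 1)
    (U : Fin 4 → Set (Set ι)) (S : Finset ι) (hU : ∀ j, IsUpperSet (U j))
    (hUS : ∀ j, DeterminedBy (U j) (↑S : Set ι)) (hne : ∀ j, (U j).Nonempty) (h0 : ∀ j, (∅ : Set ι) ∉ U j)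
    (hno : ∀ m : Fin 4, ¬ SuppZeroFlag 3 (fun j => U (m.succAbove j)))
    (hc : ¬ ∃ e : ι, ∀ j, ∃ ω, e ∉ ω ∧ ω ∉ U j ∧ insert e ω ∈ U j)
    (hpriv : ¬ ∃ e : ι, ∃ c : Fin 4, (∃ ω, e ∉ ω ∧ ω ∉ U c ∧ insert e ω ∈ U c) ∧ ∀ j, j ≠ c → ¬ Affects (U j) e)
    (hmin : ∀ e ∈ S, ∀ b : Bool, SuppZeroFlag 4 (fun j => secAt e b (U j)))
    (habs : ∀ j, ∃ l, l ≠ j ∧ ¬ U l ⊆ U j) :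
    sahiE (bernoulliWeight p) 4 (fun j => ind (U j)) = 0 ↔ SuppZeroFlag 4 U :=
  sahiE_ind_eq_zero_iff_of_combPos hU (combPos_sahiE_four_of_terminal U S hU hUS hne h0 hno hc hpriv hmin habs) hp

/-- **Terminal quadruples have `E₄(μ_p) > 0` at EVERY interior `p`** (they lie outside `Z₄`: no `Z₃` deletion). [this work] -/
theorem sahiE_four_ind_pos_of_terminal (p : ι → unitInterval) (hp : ∀ e, (p e : ℝ) ∈ Set.Ioo (0 : ℝ) 1)
    (U : Fin 4 → Set (Set ι)) (S : Finset ι) (hU : ∀ j, IsUpperSet (U j))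
    (hUS : ∀ j, DeterminedBy (U j) (↑S : Set ι)) (hne : ∀ j, (U j).Nonempty) (h0 : ∀ j, (∅ : Set ι) ∉ U j)
    (hno : ∀ m : Fin 4, ¬ SuppZeroFlag 3 (fun j => U (m.succAbove j)))
    (hc : ¬ ∃ e : ι, ∀ j, ∃ ω, e ∉ ω ∧ ω ∉ U j ∧ insert e ω ∈ U j)
    (hpriv : ¬ ∃ e : ι, ∃ c : Fin 4, (∃ ω, e ∉ ω ∧ ω ∉ U c ∧ insert e ω ∈ U c) ∧ ∀ j, j ≠ c → ¬ Affects (U j) e)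
    (hmin : ∀ e ∈ S, ∀ b : Bool, SuppZeroFlag 4 (fun j => secAt e b (U j)))
    (habs : ∀ j, ∃ l, l ≠ j ∧ ¬ U l ⊆ U j) :
    0 < sahiE (bernoulliWeight p) 4 (fun j => ind (U j)) :=
  sahiE_ind_pos_of_combPos hU (combPos_sahiE_four_of_terminal U S hU hUS hne h0 hno hc hpriv hmin habs)
    (fun hZ => by obtain ⟨m, hm, -⟩ := hZ; exact hno m hm) hp

end PrincipalCapFour

end Pointwise

end Summit.CriticalPhenomena.PercolationContinuityZ3.Theorems
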